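import Summits.BirchSwinnertonDyer.BirchSwinnertonDyer.Theses.AdditiveBranchIMC
import HarnessLib

/-! BC3 birth skeleton for crux `AdditiveBranchIMC.GordTwoRankOne` (route AdditiveBranchIMC, rung K1):
v2 (A12-admitted shape, planner g12): named stubs (the ONLY sorried declarations) + the kernel-checked composition `GordTwoRankOne_of` concluding the crux BY NAME. -/

set_option autoImplicit false

set_option linter.dupNamespace false

namespace Summit.BirchSwinnertonDyer.BirchSwinnertonDyer.Cruxes.GordTwoRankOne.Birth

open scoped Classical

open WeierstrassCurve Literature.NumberTheory.EllipticCurves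
  Literature.NumberTheory.EllipticCurves.ModularForms
  Literature.NumberTheory.EllipticCurves.GreenbergVatsal2000
  Literature.NumberTheory.EllipticCurves.Rank1Residual
  Literature.NumberTheory.EllipticCurves.Rank1Residual.Typed
  Literature.NumberTheory.GaloisRepresentations
  IsDedekindDomain NumberField

open Summit.BirchSwinnertonDyer.Rank1Residual.Additive
open Summit.BirchSwinnertonDyer.BirchSwinnertonDyer.Theses.AdditiveBranchIMC

/-- stub (caseOne): rank 1, rows WITH a Case-1 member: gz's end state `ClassX3Gord.bsdp_rankOne_of_facts_of_delbourgoDatumFact_of_branchCoeffOneNeZero[Odd]` on the member (Delbourgo 2002 Thm (A)+(B), the branch p-adic Gross–Zagier leading term `delbourgoDatum_rankOne_leadingTerms` = PROOF-gz Thm 1 (cell theorem, condition GZ-H), A′ ≠ 0 per pair) ∘ Cassels transport. -/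
theorem stub_caseOne :
    ∀ (W : WeierstrassCurve ℚ) [W.IsElliptic] [W.IsGloballyMinimal] (p : ℕ) [Fact p.Prime],
      W.analyticRank = 1 → N10.CellGordTwo W p → HasCaseOneMember W p → MissingLowerBoundAt W p := by
  sorry

/-- stub (offCaseOne): rank 1, rows with NO Case-1 member (irreducible E[p], or reducible in μ-territory): branch IMC ⊆(𝓛) in rank 1 + p-adic GZ on the branch + Schneider non-degeneracy; nothing in print. -/
theorem stub_offCaseOne :
    ∀ (W : WeierstrassCurve ℚ) [W.IsElliptic] [W.IsGloballyMinimal] (p : ℕ) [Fact p.Prime],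
      W.analyticRank = 1 → N10.CellGordTwo W p → ¬ HasCaseOneMember W p → MissingLowerBoundAt W p := by
  sorry

/-- BC3 composition = THE SKELETON (A12 shape, v2): the crux BY NAME with NO hypotheses, from exactly the two
registered stubs (rows with / without a Case-1 member); kernel-checked, no sorry of its own. -/
theorem GordTwoRankOne_of :
    Summit.BirchSwinnertonDyer.BirchSwinnertonDyer.Theses.AdditiveBranchIMC.GordTwoRankOne := by
  intro W _ _ p _ hr hc
  by_cases hm : HasCaseOneMember W p
  · exact stub_caseOne W p hr hc hm
  · exact stub_offCaseOne W p hr hc hm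

end Summit.BirchSwinnertonDyer.BirchSwinnertonDyer.Cruxes.GordTwoRankOne.Birth
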